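/-
Copyright (c) 2026 the pub-hodgecm-mathlib formalisation cell (harness21).  Prover seat hodgecm-mathlib-F0P3b-p01 (g11), 2026-09-01.  Road «S3-tree» (census «S3» v3, architect
A-p16 (g29) A-61∕A-65), brick T3′ «depth-zero κ-transfer», organ O8a-3 «EIGENFRAME TRANSPORT» of the holder's O8 sub-deal: the cyclic lattice of `τ = P·diag(γ)·P⁻¹` on
`w = P a` is `P·(O[γ]·a)`, its Gram matrix is `(σV)ᵀ·diag(d a σa)·V`, and «Gram ∈ GL_n(𝒪)» ⟺ «`a` is GOOD» (the token of ★ O8a-1's torsor count).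
-/
import Literature.NumberTheory.Automorphic.SplitTorusOrderCyclicLattices   -- ★ O7 (brings ★ O6 `gram_cyclic_eq`, `det_gram_cyclic`, `gram_cyclic_integral_iff`; O7 `apply_mem_of_mem_span_pow`)
import Literature.NumberTheory.Automorphic.HeckeTransversalGL              -- ★ `IsIntegralMatrix`, `glInt`, `valuation F` ((D0) currency)
import Literature.NumberTheory.Automorphic.UnitaryGroupFormTransport        -- ★ `formCongr σ T H = (σT)ᵀ H T`
import Mathlib.LinearAlgebra.Vandermonde
import HarnessLib

/-!
# Eigenframe transport for cyclic lattices: `span{τ^j (P a)} = P·(O[γ]·a)`, Gram `= (σV)ᵀ diag(d·a·σa) V`, and «unimodular Gram ⟺ GOOD `a`»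

Topic `NumberTheory/Automorphic`; namespace `Literature.NumberTheory.Automorphic`.  THEOREMS ONLY (no definition, no instance, no notation, no named fact, no `sorry`); §1 over any
field `K` and subring `O`, §2 in (D0)'s `[Field F] [ValuativeRel F]` currency (`𝒪[F]`, `valuation F`, ★ `IsIntegralMatrix`).  Cell `pub/hodgecm-mathlib`, crux H413 =
`stmt-HodgeConjecture-24833`; road «S3-tree», brick T3′, organ **O8a-3** — the SEAM between A-p12 (g21)'s fixed-coset∕cyclic-lattice sets (★ `ResiduallyUnipotentCyclicLattices`:
`Λ(g) = span 𝒪 {τ^j *ᵥ w}`) and ★ O8a-1 `SplitTorusOrderSelfDualTorsor` (`span_O {γ^j • a}`, `a` GOOD).  HONEST LABEL: HC_CM is proved only modulo the cell's 2 remaining named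
inputs (hLiu418, h413) until rung 0 closes; elementary algebra, asserts nothing printed.

THE MATHEMATICS.  `τ = P·diag(γ)·P⁻¹` with an `h`-ORTHOGONAL eigenframe `P ∈ GL_n` (`formCongr σ P J = (σP)ᵀ J P = diag(d)`); `a : Fin n → K`, `w := P a`; `V` the Vandermonde
matrix of the eigenvalue tuple `γ`, `M_a := diag(a)·V` (columns `γ^j • a`).
* §1 `mulVec_conj_diagonal_pow` (`τ^j (P a) = P (γ^j • a)`), `transpose_mul_diagonal_vandermonde` (the columns of `P·M_a` are the `τ^j w`),
  `span_range_transpose_eq_span_pow_mulVec` and `span_range_transpose_eq_map_span_pow_mul` (`Λ(P·M_a) = span{τ^j w} = P·(O[γ]·a)`), `det_diagonal_mul_vandermonde`,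
  **`formCongr_mul_diagonal_vandermonde`**: `formCongr σ (P·M_a) J = (σV)ᵀ · diag(d_i a_i σ(a_i)) · V` — the Gram matrix of ★ O6 `gram_cyclic_eq`.
* §2 (valuation) `prod_prod_erase_valuation_sub_eq_sq` (`∏_i ∏_{j≠i} |γ_i − γ_j| = |det V|²`), `valuation_det_gram_cyclic` (`|det Gram| = ∏_i |d_i a_i σ(a_i) f′(γ_i)|`),
  `valuation_eq_one_iff_exists_mul_eq_one`, and **`isIntegralMatrix_gram_and_valuation_det_iff_good`**: for norm-one eigenvalues that are units of `O[γ]`,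
  «`Gram` integral with `|det Gram| = 1`» ⟺ «`T(a) := (d_i a_i σ(a_i) f′(γ_i))_i ∈ span_𝒪{γ^j}` with unit components» = ★ O8a-1's GOOD.

## References
* [Jacobowitz1962] R. Jacobowitz, *Hermitian forms over local fields*, Amer. J. Math. 84 (1962), §4, §7 Thm. 7.1 (Gram matrices, unimodular lattices).
* [SerreLocalFields1979] J.-P. Serre, *Local Fields* (1979), Ch. III §6 (orders `A[x]`, discriminant `= ±∏ f′(x_i)`).
* [HornJohnson2013] R. A. Horn, C. R. Johnson, *Matrix Analysis*, 2nd ed. (2013), §0.9.11 (Vandermonde matrices and `det V = ∏_{i<j}(x_j − x_i)`).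
-/

set_option autoImplicit false

open Polynomial Finset Matrix

namespace Literature.NumberTheory.Automorphic

/-! ## §1 Transport along the eigenframe (any field) -/

section Algebra

variable {K : Type*} [Field K] {n : ℕ}

/-- `(P·D·P⁻¹)^j = P·D^j·P⁻¹` for `P ∈ GL_n`. [cite: HornJohnson2013, §0.9.11] -/
theorem conj_diagonal_pow (P : GL (Fin n) K) (γ : Fin n → K) (j : ℕ) :
    ((P : Matrix (Fin n) (Fin n) K) * diagonal γ * ((P⁻¹ : GL (Fin n) K) : Matrix (Fin n) (Fin n) K)) ^ j =
      (P : Matrix (Fin n) (Fin n) K) * diagonal (γ ^ j) * ((P⁻¹ : GL (Fin n) K) : Matrix (Fin n) (Fin n) K) := by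
  have hPP : ((P⁻¹ : GL (Fin n) K) : Matrix (Fin n) (Fin n) K) * (P : Matrix (Fin n) (Fin n) K) = 1 := by
    rw [← Units.val_mul, inv_mul_cancel, Units.val_one]
  induction j with
  | zero =>
    have h1 : diagonal ((γ : Fin n → K) ^ 0) = 1 := by rw [pow_zero]; exact diagonal_one
    rw [pow_zero, h1, Matrix.mul_one, ← Units.val_mul, mul_inv_cancel, Units.val_one]
  | succ j ih =>
    have hpow : (fun i => (γ ^ j) i * γ i) = γ ^ (j + 1) := funext fun i => by simp [pow_succ]
    rw [pow_succ, ih]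
    calc (P : Matrix (Fin n) (Fin n) K) * diagonal (γ ^ j) * ((P⁻¹ : GL (Fin n) K) : Matrix (Fin n) (Fin n) K) *
          ((P : Matrix (Fin n) (Fin n) K) * diagonal γ * ((P⁻¹ : GL (Fin n) K) : Matrix (Fin n) (Fin n) K))
        = (P : Matrix (Fin n) (Fin n) K) * diagonal (γ ^ j) * ((((P⁻¹ : GL (Fin n) K) : Matrix (Fin n) (Fin n) K) * (P : Matrix (Fin n) (Fin n) K))) *
            diagonal γ * ((P⁻¹ : GL (Fin n) K) : Matrix (Fin n) (Fin n) K) := by simp only [Matrix.mul_assoc]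
      _ = (P : Matrix (Fin n) (Fin n) K) * diagonal (γ ^ (j + 1)) * ((P⁻¹ : GL (Fin n) K) : Matrix (Fin n) (Fin n) K) := by
          rw [hPP, Matrix.mul_one, Matrix.mul_assoc (P : Matrix (Fin n) (Fin n) K) (diagonal (γ ^ j)) (diagonal γ), diagonal_mul_diagonal, hpow]

/-- **`τ^j (P a) = P (γ^j • a)`** for `τ = P·diag(γ)·P⁻¹`. [cite: HornJohnson2013, §0.9.11] -/
theorem mulVec_conj_diagonal_pow (P : GL (Fin n) K) (γ a : Fin n → K) (j : ℕ) :
    ((P : Matrix (Fin n) (Fin n) K) * diagonal γ * ((P⁻¹ : GL (Fin n) K) : Matrix (Fin n) (Fin n) K)) ^ j *ᵥ ((P : Matrix (Fin n) (Fin n) K) *ᵥ a) =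
      (P : Matrix (Fin n) (Fin n) K) *ᵥ fun i => γ i ^ j * a i := by
  have hPP : ((P⁻¹ : GL (Fin n) K) : Matrix (Fin n) (Fin n) K) * (P : Matrix (Fin n) (Fin n) K) = 1 := by
    rw [← Units.val_mul, inv_mul_cancel, Units.val_one]
  have hmat : (P : Matrix (Fin n) (Fin n) K) * diagonal (γ ^ j) * ((P⁻¹ : GL (Fin n) K) : Matrix (Fin n) (Fin n) K) * (P : Matrix (Fin n) (Fin n) K) =
      (P : Matrix (Fin n) (Fin n) K) * diagonal (γ ^ j) := by
    rw [Matrix.mul_assoc, hPP, Matrix.mul_one]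
  have hdiag : diagonal (γ ^ j) *ᵥ a = fun i => γ i ^ j * a i := funext fun i => by rw [mulVec_diagonal, Pi.pow_apply]
  rw [conj_diagonal_pow, mulVec_mulVec, hmat, ← mulVec_mulVec, hdiag]

/-- The columns of `P·(diag(a)·V)` are the vectors `P (γ^j • a)`. [cite: HornJohnson2013, §0.9.11] -/
theorem transpose_mul_diagonal_vandermonde (P : Matrix (Fin n) (Fin n) K) (a γ : Fin n → K) (j : Fin n) :
    (P * (diagonal a * vandermonde γ))ᵀ j = P *ᵥ fun i => γ i ^ (j : ℕ) * a i := by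
  funext i
  rw [transpose_apply, Matrix.mul_apply, mulVec, dotProduct]
  refine Finset.sum_congr rfl fun l _ => ?_
  rw [Matrix.mul_apply, Finset.sum_eq_single l]
  · rw [diagonal_apply_eq, vandermonde_apply]; ring
  · intro b _ hb; rw [diagonal_apply_ne _ (Ne.symm hb), zero_mul]
  · intro h; exact (h (Finset.mem_univ l)).elim

/-- **`Λ(P·M_a) = span_O {τ^j w}`**, `w = P a`, `τ = P·diag(γ)·P⁻¹` (A-p12's cyclic-lattice token). [cite: Jacobowitz1962, §4] -/
theorem span_range_transpose_eq_span_pow_mulVec (O : Subring K) (P : GL (Fin n) K) (a γ : Fin n → K) :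
    Submodule.span O (Set.range ((P : Matrix (Fin n) (Fin n) K) * (diagonal a * vandermonde γ))ᵀ) =
      Submodule.span O (Set.range fun j : Fin n =>
        ((P : Matrix (Fin n) (Fin n) K) * diagonal γ * ((P⁻¹ : GL (Fin n) K) : Matrix (Fin n) (Fin n) K)) ^ (j : ℕ) *ᵥ ((P : Matrix (Fin n) (Fin n) K) *ᵥ a)) := by
  congr 1
  ext x
  simp only [Set.mem_range]
  constructor
  · rintro ⟨j, rfl⟩; exact ⟨j, by rw [mulVec_conj_diagonal_pow, transpose_mul_diagonal_vandermonde]⟩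
  · rintro ⟨j, rfl⟩; exact ⟨j, by rw [mulVec_conj_diagonal_pow, transpose_mul_diagonal_vandermonde]⟩

/-- **`Λ(P·M_a) = P·(O[γ]·a)`** (O8a-1's token `span_O {γ^j • a}` pushed by `P`). [cite: Jacobowitz1962, §4] -/
theorem span_range_transpose_eq_map_span_pow_mul (O : Subring K) (P : Matrix (Fin n) (Fin n) K) (a γ : Fin n → K) :
    Submodule.span O (Set.range (P * (diagonal a * vandermonde γ))ᵀ) =
      (Submodule.span O (Set.range fun j : Fin n => fun i => γ i ^ (j : ℕ) * a i)).map ((Matrix.toLin' P).restrictScalars O) := by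
  rw [Submodule.map_span, ← Set.range_comp]
  congr 1
  ext x
  simp only [Set.mem_range, Function.comp_apply, LinearMap.coe_restrictScalars, Matrix.toLin'_apply]
  constructor
  · rintro ⟨j, rfl⟩; exact ⟨j, by rw [transpose_mul_diagonal_vandermonde]⟩
  · rintro ⟨j, rfl⟩; exact ⟨j, by rw [transpose_mul_diagonal_vandermonde]⟩

/-- `det(diag(a)·V) = ∏ a_i · det V`, non-zero for `a_i ≠ 0` and injective `γ`. [cite: HornJohnson2013, §0.9.11] -/
theorem det_diagonal_mul_vandermonde_ne_zero {a γ : Fin n → K} (ha : ∀ i, a i ≠ 0) (hγ : Function.Injective γ) :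
    (diagonal a * vandermonde γ).det ≠ 0 := by
  rw [det_mul, det_diagonal]
  exact mul_ne_zero (Finset.prod_ne_zero_iff.2 fun i _ => ha i) (det_vandermonde_ne_zero_iff.2 hγ)

/-- **THE GRAM MATRIX IN THE EIGENFRAME: `formCongr σ (P·M_a) J = (σV)ᵀ · diag(d_i a_i σ(a_i)) · V`** when `formCongr σ P J = diag(d)` (the eigenframe is `h`-orthogonal
with norms `d`). [cite: Jacobowitz1962, §4] -/
theorem formCongr_mul_diagonal_vandermonde (σ : K →+* K) (P : GL (Fin n) K) (J : Matrix (Fin n) (Fin n) K) (d : Fin n → K)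
    (hP : formCongr σ P J = diagonal d) (a γ : Fin n → K) (M : GL (Fin n) K) (hM : (M : Matrix (Fin n) (Fin n) K) = diagonal a * vandermonde γ) :
    formCongr σ (P * M) J = ((vandermonde γ).map σ)ᵀ * diagonal (fun i => d i * a i * σ (a i)) * vandermonde γ := by
  have hP' : ((P : Matrix (Fin n) (Fin n) K).map σ)ᵀ * J * (P : Matrix (Fin n) (Fin n) K) = diagonal d := hP
  simp only [formCongr, Units.val_mul, hM, Matrix.map_mul, Matrix.transpose_mul, diagonal_map (map_zero σ), diagonal_transpose]
  calc ((vandermonde γ).map σ)ᵀ * diagonal (fun i => σ (a i)) * ((P : Matrix (Fin n) (Fin n) K).map σ)ᵀ * J *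
        ((P : Matrix (Fin n) (Fin n) K) * (diagonal a * vandermonde γ))
      = ((vandermonde γ).map σ)ᵀ * diagonal (fun i => σ (a i)) * ((((P : Matrix (Fin n) (Fin n) K).map σ)ᵀ * J * (P : Matrix (Fin n) (Fin n) K))) *
          (diagonal a * vandermonde γ) := by simp only [Matrix.mul_assoc]
    _ = ((vandermonde γ).map σ)ᵀ * (diagonal (fun i => σ (a i)) * diagonal d * diagonal a) * vandermonde γ := by
        rw [hP']; simp only [Matrix.mul_assoc]
    _ = ((vandermonde γ).map σ)ᵀ * diagonal (fun i => d i * a i * σ (a i)) * vandermonde γ := by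
        rw [diagonal_mul_diagonal, diagonal_mul_diagonal]
        congr 2
        ext i j
        by_cases hij : i = j
        · subst hij; rw [diagonal_apply_eq, diagonal_apply_eq]; ring
        · rw [diagonal_apply_ne _ hij, diagonal_apply_ne _ hij]

end Algebra

/-! ## §2 «Unimodular Gram ⟺ GOOD» in the `ValuativeRel` currency -/

section Valuation

open scoped ValuativeRel
open ValuativeRel

variable {F : Type*} [Field F] [ValuativeRel F] {n : ℕ}

/-- `∏_i ∏_{j ≠ i} |γ_i − γ_j| = |det V|²` (`det V = ∏_{i<j} (γ_j − γ_i)`, Mathlib `det_vandermonde`). [cite: SerreLocalFields1979, Ch. III §6] [cite: HornJohnson2013, §0.9.11] -/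
theorem prod_prod_erase_valuation_sub_eq_sq (γ : Fin n → F) :
    ∏ i, ∏ j ∈ univ.erase i, valuation F (γ i - γ j) = (valuation F (vandermonde γ).det) ^ 2 := by
  have hsplit : ∀ i : Fin n, ∏ j ∈ univ.erase i, valuation F (γ i - γ j) =
      (∏ j ∈ Ioi i, valuation F (γ i - γ j)) * ∏ j ∈ Iio i, valuation F (γ i - γ j) := by
    intro i
    rw [← Finset.compl_singleton, ← Finset.Ioi_disjUnion_Iio, Finset.prod_disjUnion]
  rw [Finset.prod_congr rfl fun i _ => hsplit i, Finset.prod_mul_distrib]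
  have hcomm : ∏ i : Fin n, ∏ j ∈ Iio i, valuation F (γ i - γ j) = ∏ j : Fin n, ∏ i ∈ Ioi j, valuation F (γ i - γ j) :=
    Finset.prod_comm' fun i j => by simp only [Finset.mem_univ, true_and, and_true, Finset.mem_Iio, Finset.mem_Ioi]
  rw [hcomm, det_vandermonde, map_prod, sq]
  congr 1
  · refine Finset.prod_congr rfl fun i _ => ?_
    rw [map_prod]
    exact Finset.prod_congr rfl fun j _ => Valuation.map_sub_swap _ _ _
  · exact Finset.prod_congr rfl fun j _ => by rw [map_prod]

/-- **`|det Gram| = ∏_i |d_i a_i σ(a_i) · f′(γ_i)|`** for the Gram matrix of the cyclic lattice (`σ` valuation-preserving): ★ O6 `det_gram_cyclic` + §2's square identity.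
[cite: SerreLocalFields1979, Ch. III §6] -/
theorem valuation_det_gram_cyclic (σ : F →+* F) (hσv : ∀ x, valuation F (σ x) = valuation F x) (γ δ : Fin n → F) :
    valuation F (Matrix.of fun j k : Fin n => ∑ i, δ i * σ (γ i) ^ (j : ℕ) * γ i ^ (k : ℕ)).det =
      ∏ i, valuation F (δ i * ∏ j ∈ univ.erase i, (γ i - γ j)) := by
  rw [det_gram_cyclic, map_mul, map_mul, hσv, map_prod]
  simp_rw [map_mul, map_prod]
  rw [Finset.prod_mul_distrib, prod_prod_erase_valuation_sub_eq_sq, sq]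
  ac_rfl

/-- For `t ∈ 𝒪`: `|t| = 1 ⟺ t` is a unit of `𝒪` (`∃ y ∈ 𝒪, y t = 1`). [cite: SerreLocalFields1979, Ch. III §6] -/
theorem valuation_eq_one_iff_exists_mul_eq_one {t : F} (ht : t ∈ 𝒪[F]) : valuation F t = 1 ↔ ∃ y ∈ 𝒪[F], y * t = 1 := by
  constructor
  · intro h1
    have ht0 : t ≠ 0 := fun h0 => by rw [h0, map_zero] at h1; exact zero_ne_one h1
    exact ⟨t⁻¹, (Valuation.mem_integer_iff _ _).2 (by rw [map_inv₀, h1, inv_one]), inv_mul_cancel₀ ht0⟩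
  · rintro ⟨y, hy, hyt⟩
    have hy1 : valuation F y ≤ 1 := (Valuation.mem_integer_iff _ _).1 hy
    have ht1 : valuation F t ≤ 1 := (Valuation.mem_integer_iff _ _).1 ht
    have hprod : valuation F y * valuation F t = 1 := by rw [← map_mul, hyt, map_one]
    refine le_antisymm ht1 (not_lt.1 fun hlt => ?_)
    rw [mul_comm] at hprod
    exact absurd hprod (ne_of_lt (mul_lt_one_of_lt_of_le hlt hy1))

/-- **«UNIMODULAR GRAM ⟺ GOOD».**  Norm-one eigenvalues `γ_i ∈ 𝒪` (`σ(γ_i) = γ_i⁻¹`) which are units of `O[γ]` (`γ_i⁻¹ = r(γ_i)`, one `r ∈ 𝒪[X]`), `σ` valuation-preserving,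
`δ_i := d_i a_i σ(a_i)`: the Gram matrix `G = (Σ_i δ_i σ(γ_i)^j γ_i^k)_{jk}` of the cyclic lattice `O[γ]·a` for `diag(d)` is INTEGRAL with `|det G| = 1` iff the criterion vector
`T(a) = (δ_i f′(γ_i))_i` lies in `span_𝒪 {γ^j}` with every component a unit — ★ O8a-1's GOOD predicate, token for token. [cite: Jacobowitz1962, §4, §7 Thm. 7.1]
[cite: SerreLocalFields1979, Ch. III §6] -/
theorem isIntegralMatrix_gram_and_valuation_det_iff_good (σ : F →+* F) (hσv : ∀ x, valuation F (σ x) = valuation F x) {γ : Fin n → F}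
    (hγ : ∀ i, γ i ∈ 𝒪[F]) (hinj : Function.Injective γ) (hσγ : ∀ i, σ (γ i) = (γ i)⁻¹)
    {r : (𝒪[F])[X]} (hr : ∀ i, (r.map (𝒪[F]).subtype).eval (γ i) * γ i = 1) (d a : Fin n → F) :
    (IsIntegralMatrix (Matrix.of fun j k : Fin n => ∑ i, (d i * a i * σ (a i)) * σ (γ i) ^ (j : ℕ) * γ i ^ (k : ℕ)) ∧
        valuation F (Matrix.of fun j k : Fin n => ∑ i, (d i * a i * σ (a i)) * σ (γ i) ^ (j : ℕ) * γ i ^ (k : ℕ)).det = 1) ↔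
      ((fun i => d i * a i * σ (a i) * ∏ j ∈ univ.erase i, (γ i - γ j)) ∈ Submodule.span 𝒪[F] (Set.range fun j : Fin n => fun i => γ i ^ (j : ℕ)) ∧
        ∀ i, ∃ y ∈ 𝒪[F], y * (d i * a i * σ (a i) * ∏ j ∈ univ.erase i, (γ i - γ j)) = 1) := by
  have hint : IsIntegralMatrix (Matrix.of fun j k : Fin n => ∑ i, (d i * a i * σ (a i)) * σ (γ i) ^ (j : ℕ) * γ i ^ (k : ℕ)) ↔
      (fun i => d i * a i * σ (a i) * ∏ j ∈ univ.erase i, (γ i - γ j)) ∈ Submodule.span 𝒪[F] (Set.range fun j : Fin n => fun i => γ i ^ (j : ℕ)) := by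
    unfold IsIntegralMatrix
    exact gram_cyclic_integral_iff (𝒪[F]) hγ hinj σ hσγ hr (fun i => d i * a i * σ (a i))
  rw [hint, valuation_det_gram_cyclic σ hσv]
  constructor
  · rintro ⟨hmem, hdet⟩
    refine ⟨hmem, fun i => ?_⟩
    have hle : ∀ i ∈ (univ : Finset (Fin n)), valuation F (d i * a i * σ (a i) * ∏ j ∈ univ.erase i, (γ i - γ j)) ≤ 1 :=
      fun i _ => (Valuation.mem_integer_iff _ _).1 (apply_mem_of_mem_span_pow (𝒪[F]) hγ hmem i)
    exact (valuation_eq_one_iff_exists_mul_eq_one (apply_mem_of_mem_span_pow (𝒪[F]) hγ hmem i)).1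
      ((Finset.prod_eq_one_iff_of_le_one' hle).1 hdet i (Finset.mem_univ i))
  · rintro ⟨hmem, hunit⟩
    refine ⟨hmem, ?_⟩
    exact Finset.prod_eq_one fun i _ => (valuation_eq_one_iff_exists_mul_eq_one (apply_mem_of_mem_span_pow (𝒪[F]) hγ hmem i)).2 (hunit i)

end Valuation

end Literature.NumberTheory.Automorphic
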